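/-
Copyright (c) 2026 the pub-hodgecm-mathlib formalisation cell (harness21).  Prover seat hodgecm-mathlib-R90-IF-p01 (g0), programme R90-TF, section S9 «InnerForm-13.3.6 (c)»,
hand B3d-(d2) «MEASURE DATA RIDE THE LOCAL CONGRUENCE» (R90-IF-plan NEW DEAL, R90 bus 2026-09-04T16:06:28Z) beneath `R90.S9.sock_S9_similitudeTransport`.
-/
import Literature.NumberTheory.Rogawski1990.LocalTransferTransportCanonical          -- ★ `OrbitalMeasureFamily.IsCanonical.transport`, `transport_isCanonical_isRegularElt`, `isRegularElt_iff_of_isConj_local`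
import Literature.NumberTheory.Automorphic.LocalUnitaryGroupSimilitude               -- ★ `corresponds_cmDatumLocalCongr`, `corresponds_comm`
import Literature.NumberTheory.Automorphic.UnitaryGroupOrbitalMeasureOfLocalQuotient  -- ★ `isMulRightInvariant_map_mulEquiv_of_isMulRightInvariant`
import Literature.NumberTheory.Automorphic.AdelicCongruenceLocalCompat               -- ★ `formCongr_toLocalGL_one_smul` (the rational similitude read over `L ⊗ L⁺_v`)
import HarnessLib

/-!
# R90-TF · S9 — (B3d-d2) the orbital-measure DATA of (B0) ride the local congruence `U(H)(L⁺_v) ≃ U(Φ₃)(L⁺_v)`: Haar measures push forward to Haar measures, canonical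
# orbital-measure families to canonical ones (Rogawski 1990 §4.3 (4.3.1) p. 43, §14.2 (14.2.1) p. 232 «we fix an isomorphism `ψ_v : G′_v → G_v`»; Deitmar–Echterhoff 2014 Thm. 1.5.3)

Cell `hodgecm-mathlib`, crux H413 = `stmt-HodgeConjecture-24833` (supports-only, count-neutral), route of record `HCCMUnconditional`; programme R90-TF (brief
`director/R90-BRIEF.v2.md` 1f40d54518340a35), section S9 = InnerForm-13.3.6 (c), seat R90-IF-p01 (g0); deal «B3d-(d2)» (R90-IF-plan 16:06:28Z; B3d split by kind, R90-IF-p03 keeps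
(d1) ∕ (d3) ∕ (d4)).  THEOREMS ONLY (no `def`, no `instance`, no named-fact hypothesis, no `sorry`).  CONVENTION = R90-IF-p03's `CENSUS-B3d.md` §0: at a finite `v` a (B0)-frame
`ᵗ((σ⊗1)T)·H_v·T = a • (Φ₃)_v` gives ★ `e := cmDatumLocalCongr L v T ha h : U(Φ₃)(L⁺_v) ≃ₜ* U(H)(L⁺_v)` (`g₀ ↦ T g₀ T⁻¹`); the `Φ₃`-side data are `ν₀ := (e⁻¹)_* ν_G`,
`m₀ := (e⁻¹)_* m_G` (★ `OrbitalMeasureFamily.transport`), the `U(2)×U(1)`-side data `(m_H, ν_H)` are UNCHANGED (they live on `cmDatum L 2 Φ₂ × cmDatum L 1 Φ₁`, which does not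
see `H`), measurable structures on the `Φ₃` side arbitrary Borel ones (binders, as in (B0)).  For (B3) the frame is the `v`-component of the rational similitude
`ᵗB̄ (a • Φ₃) B = H`: `T = B_v⁻¹`, `a_v = a` (§2), so that `e⁻¹ = (g ↦ B_v g B_v⁻¹)` is the place-`v` component of ★ p861490's `Φ` (★ `R90S9SimilCongrLocalEquiv`, pointwise).

* §1 (any (B0)-frame at `v`) `isMulRightInvariant_map_cmDatumLocalCongr_symm` — `(e⁻¹)_* ν_G` is right invariant (Haar is a Mathlib instance, ★ `ContinuousMulEquiv.isHaarMeasure_map`);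
  **`isCanonical_transport_cmDatumLocalCongr_symm`** — `(e⁻¹)_* m_G` is CANONICAL on the regular classes of `U(Φ₃)(L⁺_v)` for `ν₀ = (e⁻¹)_* ν_G` when `m_G` is canonical on the regular
  classes of `U(H)(L⁺_v)` for `ν_G` (★ `OrbitalMeasureFamily.IsCanonical.transport`: regularity is a class function, ★ `isRegularElt_iff_of_isConj_local`, preserved by the
  correspondence `γ₀ ↔ T γ₀ T⁻¹`, ★ `corresponds_cmDatumLocalCongr` ∕ ★ `isRegularElt_of_isConj`) — the (d2) clause of (B0)'s `hcan` at `Φ₃`, its `m_H`-conjunct being untouched.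
* §2 (the (B3) frame) `formCongr_toLocalGL_inv_smul` — `ᵗ((σ⊗1)B_v⁻¹)·H_v·B_v⁻¹ = a_v • (Φ₃)_v` from `ᵗB̄ (a • Φ₃) B = H`; `isUnit_algebraMap_localRing` — `a_v` is a unit; and the assembled
  **`congrOrbitalData_of_simil`**: for (B0)'s `H`-side `(m_G, ν_G)` (Haar, right invariant, canonical at every `v`) the `Φ₃`-side data along `e_v := cmDatumLocalCongr L v B_v⁻¹ _ _`
  are right invariant and canonical at every `v` — (B0)'s binders `[∀ v, IsHaarMeasure]`, `[∀ v, IsMulRightInvariant]`, `hcan` at `Φ₃` BY SHAPE.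
HONEST LABEL: plumbing; proves no printed statement about automorphic forms; HC_CM is proved only modulo the 7 printed citations (2 remaining named inputs: hLiu418 =
`stmt-HodgeConjecture-24832`, h413 = `stmt-HodgeConjecture-24833`) until rung 0 closes.

## References
* [Rogawski1990] J. D. Rogawski, *Automorphic Representations of Unitary Groups in Three Variables*, Ann. of Math. Stud. 123 (1990), §4.3 (4.3.1) p. 43; §14.2 (14.2.1) p. 232.
* [DeitmarEchterhoff2014] A. Deitmar, S. Echterhoff, *Principles of Harmonic Analysis*, 2nd ed. (2014), Thm. 1.5.3 (the invariant quotient measure).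
* [PlatonovRapinchuk1994] V. Platonov, A. Rapinchuk, *Algebraic Groups and Number Theory* (1994), §2.3.
-/

set_option autoImplicit false
set_option linter.dupNamespace false  -- the mandated namespace repeats the summit's segment (`HodgeConjecture.HodgeConjecture`)

noncomputable section

open NumberField IsDedekindDomain MeasureTheory Measure Topology
open scoped Matrix MatrixGroups
open Literature.NumberTheory Literature.NumberTheory.Automorphic Literature.NumberTheory.Automorphic.UnitaryGroup
open Literature.NumberTheory.Rogawski1990 Literature.NumberTheory.GaloisRepresentations

namespace Summit.HodgeConjecture.HodgeConjecture.R90.S9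

/-! ## §1 Any (B0)-frame at `v`: `e = cmDatumLocalCongr L v T ha h : U(Φ₃)(L⁺_v) ≃ₜ* U(H)(L⁺_v)` -/

section OnePlace

variable (L : Type) [Field L] [NumberField L] [IsCMField L] (H : Matrix (Fin 3) (Fin 3) L) (v : HeightOneSpectrum (𝓞 ↥(maximalRealSubfield L)))
  [MeasurableSpace ((cmDatum L 3 H).Local v)] [BorelSpace ((cmDatum L 3 H).Local v)]
  [MeasurableSpace ((cmDatum L 3 (Matrix.of fun i j : Fin 3 => if i.val + j.val + 1 = 3 then (1 : L) else 0)).Local v)]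
  [BorelSpace ((cmDatum L 3 (Matrix.of fun i j : Fin 3 => if i.val + j.val + 1 = 3 then (1 : L) else 0)).Local v)]
  [∀ γ : (cmDatum L 3 H).Local v, MeasurableSpace ((cmDatum L 3 H).Local v ⧸ Subgroup.centralizer ({γ} : Set ((cmDatum L 3 H).Local v)))]
  [∀ γ : (cmDatum L 3 H).Local v, BorelSpace ((cmDatum L 3 H).Local v ⧸ Subgroup.centralizer ({γ} : Set ((cmDatum L 3 H).Local v)))]
  [∀ γ : (cmDatum L 3 (Matrix.of fun i j : Fin 3 => if i.val + j.val + 1 = 3 then (1 : L) else 0)).Local v,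
    MeasurableSpace ((cmDatum L 3 (Matrix.of fun i j : Fin 3 => if i.val + j.val + 1 = 3 then (1 : L) else 0)).Local v ⧸
      Subgroup.centralizer ({γ} : Set ((cmDatum L 3 (Matrix.of fun i j : Fin 3 => if i.val + j.val + 1 = 3 then (1 : L) else 0)).Local v)))]
  [∀ γ : (cmDatum L 3 (Matrix.of fun i j : Fin 3 => if i.val + j.val + 1 = 3 then (1 : L) else 0)).Local v,
    BorelSpace ((cmDatum L 3 (Matrix.of fun i j : Fin 3 => if i.val + j.val + 1 = 3 then (1 : L) else 0)).Local v ⧸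
      Subgroup.centralizer ({γ} : Set ((cmDatum L 3 (Matrix.of fun i j : Fin 3 => if i.val + j.val + 1 = 3 then (1 : L) else 0)).Local v)))]
  (T : GL (Fin 3) (LocalRing L v)) {a : LocalRing L v} (ha : IsUnit a)
  (h : formCongr (conjLocal L (IsCMField.complexConj L) v) T (H.map (algebraMap L (LocalRing L v))) =
    a • (Matrix.of fun i j : Fin 3 => if i.val + j.val + 1 = 3 then (1 : L) else 0).map (algebraMap L (LocalRing L v)))

omit
  [∀ γ : (cmDatum L 3 H).Local v, MeasurableSpace ((cmDatum L 3 H).Local v ⧸ Subgroup.centralizer ({γ} : Set ((cmDatum L 3 H).Local v)))]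
  [∀ γ : (cmDatum L 3 H).Local v, BorelSpace ((cmDatum L 3 H).Local v ⧸ Subgroup.centralizer ({γ} : Set ((cmDatum L 3 H).Local v)))]
  [∀ γ : (cmDatum L 3 (Matrix.of fun i j : Fin 3 => if i.val + j.val + 1 = 3 then (1 : L) else 0)).Local v,
    MeasurableSpace ((cmDatum L 3 (Matrix.of fun i j : Fin 3 => if i.val + j.val + 1 = 3 then (1 : L) else 0)).Local v ⧸
      Subgroup.centralizer ({γ} : Set ((cmDatum L 3 (Matrix.of fun i j : Fin 3 => if i.val + j.val + 1 = 3 then (1 : L) else 0)).Local v)))]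
  [∀ γ : (cmDatum L 3 (Matrix.of fun i j : Fin 3 => if i.val + j.val + 1 = 3 then (1 : L) else 0)).Local v,
    BorelSpace ((cmDatum L 3 (Matrix.of fun i j : Fin 3 => if i.val + j.val + 1 = 3 then (1 : L) else 0)).Local v ⧸
      Subgroup.centralizer ({γ} : Set ((cmDatum L 3 (Matrix.of fun i j : Fin 3 => if i.val + j.val + 1 = 3 then (1 : L) else 0)).Local v)))] in
/-- **`(e⁻¹)_* ν_G` is right invariant** on `U(Φ₃)(L⁺_v)` when `ν_G` is right invariant on `U(H)(L⁺_v)` (★ `isMulRightInvariant_map_mulEquiv_of_isMulRightInvariant`; that it is a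
Haar measure is the Mathlib instance `ContinuousMulEquiv.isHaarMeasure_map`). [cite: Rogawski1990, §14.2 (14.2.1) p. 232] -/
theorem isMulRightInvariant_map_cmDatumLocalCongr_symm (νG : Measure ((cmDatum L 3 H).Local v)) [νG.IsMulRightInvariant] :
    (νG.map (cmDatumLocalCongr L v T ha h).symm).IsMulRightInvariant :=
  Literature.MeasureTheory.Group.isMulRightInvariant_map_mulEquiv_of_isMulRightInvariant (cmDatumLocalCongr L v T ha h).symm.toMulEquiv
    (cmDatumLocalCongr L v T ha h).symm.continuous.measurable νG

/-- **`(e⁻¹)_* m_G` is CANONICAL on the regular classes of `U(Φ₃)(L⁺_v)`** for the Haar measure `(e⁻¹)_* ν_G`, when `m_G` is canonical on the regular classes of `U(H)(L⁺_v)` for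
`ν_G` — the (d2) clause of (B0)'s `hcan` on the `Φ₃` side: ★ `OrbitalMeasureFamily.IsCanonical.transport` along `e⁻¹` (regularity is a class function, ★
`isRegularElt_iff_of_isConj_local`; `γ₀ ↔ e γ₀` correspond, ★ `corresponds_cmDatumLocalCongr`, so regularity transports, ★ `isRegularElt_of_isConj`).
[cite: Rogawski1990, §4.3 (4.3.1) p. 43; §14.2 (14.2.1) p. 232] [cite: DeitmarEchterhoff2014, Thm. 1.5.3] -/
theorem isCanonical_transport_cmDatumLocalCongr_symm (νG : Measure ((cmDatum L 3 H).Local v)) [νG.IsHaarMeasure] [νG.IsMulRightInvariant]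
    (ν₀ : Measure ((cmDatum L 3 (Matrix.of fun i j : Fin 3 => if i.val + j.val + 1 = 3 then (1 : L) else 0)).Local v)) [ν₀.IsHaarMeasure] [ν₀.IsMulRightInvariant]
    (hν₀ : ν₀ = νG.map (cmDatumLocalCongr L v T ha h).symm)
    {mG : OrbitalMeasureFamily ((cmDatum L 3 H).Local v)} (hmG : mG.IsCanonical (fun γ => IsRegularElt (γ.val : GL (Fin 3) (LocalRing L v))) νG) :
    (mG.transport (cmDatumLocalCongr L v T ha h).symm.toMulEquiv (cmDatumLocalCongr L v T ha h).symm.continuous (cmDatumLocalCongr L v T ha h).continuous).IsCanonical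
      (fun γ => IsRegularElt (γ.val : GL (Fin 3) (LocalRing L v))) ν₀ :=
  hmG.transport (cmDatumLocalCongr L v T ha h).symm.toMulEquiv (cmDatumLocalCongr L v T ha h).symm.continuous (cmDatumLocalCongr L v T ha h).continuous
    (fun _ _ hbb' => isRegularElt_iff_of_isConj_local L H v hbb')
    (fun γ hγ => isRegularElt_of_isConj (corresponds_comm.1 (corresponds_cmDatumLocalCongr L v T ha h γ)).symm hγ) νG ν₀ hν₀

end OnePlace

/-! ## §2 The (B3) frame `T = B_v⁻¹`, `a_v = a` at every finite `v`, and the assembled (d2) data -/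

section Simil

variable (L : Type) [Field L] [NumberField L] [IsCMField L] (H : Matrix (Fin 3) (Fin 3) L)

/-- **The (B3) frame at `v`**: from the rational similitude `ᵗB̄ (a • Φ₃) B = H` (`formCongr (cmConjRingHom L) B (a • Φ₃) = H`), over `L ⊗ L⁺_v`:
`ᵗ((σ⊗1)B_v⁻¹)·H_v·B_v⁻¹ = a_v • (Φ₃)_v` — the hypothesis of ★ `cmDatumLocalCongr L v B_v⁻¹ _ _ : U(Φ₃)(L⁺_v) ≃ₜ* U(H)(L⁺_v)` (R90-IF-p03's convention `T_v = B_v⁻¹`, `a_v = a`),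
by ★ `formCongr_inv_formCongr` and ★ `formCongr_toLocalGL_one_smul`. [cite: PlatonovRapinchuk1994, §2.3] [cite: Rogawski1990, §14.2 p. 232] -/
theorem formCongr_toLocalGL_inv_smul (B : GL (Fin 3) L) {a : L}
    (hB : formCongr (cmConjRingHom L) B (a • (Matrix.of fun i j : Fin 3 => if i.val + j.val + 1 = 3 then (1 : L) else 0)) = H)
    (v : HeightOneSpectrum (𝓞 ↥(maximalRealSubfield L))) :
    formCongr (conjLocal L (IsCMField.complexConj L) v) (toLocalGL L v B)⁻¹ (H.map (algebraMap L (LocalRing L v))) =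
      algebraMap L (LocalRing L v) a • (Matrix.of fun i j : Fin 3 => if i.val + j.val + 1 = 3 then (1 : L) else 0).map (algebraMap L (LocalRing L v)) := by
  have hQ : (((B⁻¹ : GL (Fin 3) L) : Matrix (Fin 3) (Fin 3) L).map (cmConjRingHom L))ᵀ * H * ((B⁻¹ : GL (Fin 3) L) : Matrix (Fin 3) (Fin 3) L) =
      a • (Matrix.of fun i j : Fin 3 => if i.val + j.val + 1 = 3 then (1 : L) else 0) := by
    rw [← hB]
    exact formCongr_inv_formCongr (cmConjRingHom L) B _
  rw [← map_inv, formCongr_toLocalGL_one_smul L B⁻¹ hQ v, one_smul]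
  ext i j
  simp only [Matrix.map_apply, Matrix.smul_apply, smul_eq_mul, map_mul]

omit [IsCMField L] in
/-- `a_v = a ⊗ 1` is a unit for `a ≠ 0`. [folklore] -/
theorem isUnit_algebraMap_localRing {a : L} (ha0 : a ≠ 0) (v : HeightOneSpectrum (𝓞 ↥(maximalRealSubfield L))) :
    IsUnit (algebraMap L (LocalRing L v) a) :=
  (IsUnit.mk0 a ha0).map _

/-- **(B3d-d2) THE ORBITAL-MEASURE DATA OF (B0) RIDE THE CONGRUENCE — assembled at every finite place along the (B3) frames.**  For the rational similitude `ᵗB̄ (a • Φ₃) B = H`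
(`a ≠ 0`), the `H`-side data of (B0) — local Haar measures `ν_G = (ν_{G,v})_v` (right invariant) and orbital-measure families `m_G = (m_{G,v})_v` canonical on the regular classes —
and ANY Borel measurable structures on the `Φ₃` side: with `e_v := cmDatumLocalCongr L v B_v⁻¹ _ _ : U(Φ₃)(L⁺_v) ≃ₜ* U(H)(L⁺_v)` (`e_v⁻¹ = (g ↦ B_v g B_v⁻¹)` = the place-`v`
component of ★ p861490's `Φ`), the `Φ₃`-side data `ν₀ v := (e_v⁻¹)_* ν_{G,v}`, `m₀ v := (e_v⁻¹)_* m_{G,v}` are right invariant (and Haar, Mathlib instance) and CANONICAL on the regular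
classes at every `v` (for any Haar right-invariant `ν₀` with `ν₀ v = (e_v⁻¹)_* ν_{G,v}`; right invariance of that push-forward is `isMulRightInvariant_congrOrbitalData_of_simil` below,
Haar the Mathlib instance) — i.e. the `m_G`-conjunct of (B0)'s `hcan` holds at `Φ₃` BY SHAPE (the `m_H ∕ ν_H` data and conjunct are unchanged).
[cite: Rogawski1990, §4.3 (4.3.1) p. 43; §14.2 (14.2.1) p. 232] [cite: DeitmarEchterhoff2014, Thm. 1.5.3] [cite: PlatonovRapinchuk1994, §2.3] -/
theorem congrOrbitalData_of_simil (B : GL (Fin 3) L) {a : L} (ha0 : a ≠ 0)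
    (hB : formCongr (cmConjRingHom L) B (a • (Matrix.of fun i j : Fin 3 => if i.val + j.val + 1 = 3 then (1 : L) else 0)) = H)
    [∀ v : HeightOneSpectrum (𝓞 ↥(maximalRealSubfield L)), MeasurableSpace ((cmDatum L 3 H).Local v)]
    [∀ v : HeightOneSpectrum (𝓞 ↥(maximalRealSubfield L)), BorelSpace ((cmDatum L 3 H).Local v)]
    [∀ v : HeightOneSpectrum (𝓞 ↥(maximalRealSubfield L)), MeasurableSpace ((cmDatum L 3 (Matrix.of fun i j : Fin 3 => if i.val + j.val + 1 = 3 then (1 : L) else 0)).Local v)]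
    [∀ v : HeightOneSpectrum (𝓞 ↥(maximalRealSubfield L)), BorelSpace ((cmDatum L 3 (Matrix.of fun i j : Fin 3 => if i.val + j.val + 1 = 3 then (1 : L) else 0)).Local v)]
    [∀ (v : HeightOneSpectrum (𝓞 ↥(maximalRealSubfield L))) (γ : (cmDatum L 3 H).Local v),
      MeasurableSpace ((cmDatum L 3 H).Local v ⧸ Subgroup.centralizer ({γ} : Set ((cmDatum L 3 H).Local v)))]
    [∀ (v : HeightOneSpectrum (𝓞 ↥(maximalRealSubfield L))) (γ : (cmDatum L 3 H).Local v),
      BorelSpace ((cmDatum L 3 H).Local v ⧸ Subgroup.centralizer ({γ} : Set ((cmDatum L 3 H).Local v)))]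
    [∀ (v : HeightOneSpectrum (𝓞 ↥(maximalRealSubfield L))) (γ : (cmDatum L 3 (Matrix.of fun i j : Fin 3 => if i.val + j.val + 1 = 3 then (1 : L) else 0)).Local v),
      MeasurableSpace ((cmDatum L 3 (Matrix.of fun i j : Fin 3 => if i.val + j.val + 1 = 3 then (1 : L) else 0)).Local v ⧸
        Subgroup.centralizer ({γ} : Set ((cmDatum L 3 (Matrix.of fun i j : Fin 3 => if i.val + j.val + 1 = 3 then (1 : L) else 0)).Local v)))]
    [∀ (v : HeightOneSpectrum (𝓞 ↥(maximalRealSubfield L))) (γ : (cmDatum L 3 (Matrix.of fun i j : Fin 3 => if i.val + j.val + 1 = 3 then (1 : L) else 0)).Local v),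
      BorelSpace ((cmDatum L 3 (Matrix.of fun i j : Fin 3 => if i.val + j.val + 1 = 3 then (1 : L) else 0)).Local v ⧸
        Subgroup.centralizer ({γ} : Set ((cmDatum L 3 (Matrix.of fun i j : Fin 3 => if i.val + j.val + 1 = 3 then (1 : L) else 0)).Local v)))]
    (mG : ∀ v : HeightOneSpectrum (𝓞 ↥(maximalRealSubfield L)), OrbitalMeasureFamily ((cmDatum L 3 H).Local v))
    (νG : ∀ v : HeightOneSpectrum (𝓞 ↥(maximalRealSubfield L)), Measure ((cmDatum L 3 H).Local v))
    [∀ v, (νG v).IsHaarMeasure] [∀ v, (νG v).IsMulRightInvariant]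
    (hcan : ∀ v : HeightOneSpectrum (𝓞 ↥(maximalRealSubfield L)), (mG v).IsCanonical (fun γ => IsRegularElt (γ.val : GL (Fin 3) (LocalRing L v))) (νG v))
    (ν₀ : ∀ v : HeightOneSpectrum (𝓞 ↥(maximalRealSubfield L)), Measure ((cmDatum L 3 (Matrix.of fun i j : Fin 3 => if i.val + j.val + 1 = 3 then (1 : L) else 0)).Local v))
    [∀ v, (ν₀ v).IsHaarMeasure] [∀ v, (ν₀ v).IsMulRightInvariant]
    (hν₀ : ∀ v, ν₀ v = (νG v).map (cmDatumLocalCongr L v (toLocalGL L v B)⁻¹ (isUnit_algebraMap_localRing L ha0 v) (formCongr_toLocalGL_inv_smul L H B hB v)).symm) :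
    ∀ v : HeightOneSpectrum (𝓞 ↥(maximalRealSubfield L)),
      ((mG v).transport
          (cmDatumLocalCongr L v (toLocalGL L v B)⁻¹ (isUnit_algebraMap_localRing L ha0 v) (formCongr_toLocalGL_inv_smul L H B hB v)).symm.toMulEquiv
          (cmDatumLocalCongr L v (toLocalGL L v B)⁻¹ (isUnit_algebraMap_localRing L ha0 v) (formCongr_toLocalGL_inv_smul L H B hB v)).symm.continuous
          (cmDatumLocalCongr L v (toLocalGL L v B)⁻¹ (isUnit_algebraMap_localRing L ha0 v) (formCongr_toLocalGL_inv_smul L H B hB v)).continuous).IsCanonical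
        (fun γ => IsRegularElt (γ.val : GL (Fin 3) (LocalRing L v))) (ν₀ v) :=
  fun v => isCanonical_transport_cmDatumLocalCongr_symm L H v _ _ _ (νG v) (ν₀ v) (hν₀ v) (hcan v)

/-- **The (d2) right-invariance binder at `Φ₃` along the (B3) frames**: `(e_v⁻¹)_* ν_{G,v}` is right invariant at every `v` ((B0)'s `[∀ v, (νG v).IsMulRightInvariant]` at `Φ₃`;
`IsHaarMeasure` is the Mathlib instance `ContinuousMulEquiv.isHaarMeasure_map`). [cite: Rogawski1990, §14.2 (14.2.1) p. 232] -/
theorem isMulRightInvariant_congrOrbitalData_of_simil (B : GL (Fin 3) L) {a : L} (ha0 : a ≠ 0)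
    (hB : formCongr (cmConjRingHom L) B (a • (Matrix.of fun i j : Fin 3 => if i.val + j.val + 1 = 3 then (1 : L) else 0)) = H)
    [∀ v : HeightOneSpectrum (𝓞 ↥(maximalRealSubfield L)), MeasurableSpace ((cmDatum L 3 H).Local v)]
    [∀ v : HeightOneSpectrum (𝓞 ↥(maximalRealSubfield L)), BorelSpace ((cmDatum L 3 H).Local v)]
    [∀ v : HeightOneSpectrum (𝓞 ↥(maximalRealSubfield L)), MeasurableSpace ((cmDatum L 3 (Matrix.of fun i j : Fin 3 => if i.val + j.val + 1 = 3 then (1 : L) else 0)).Local v)]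
    [∀ v : HeightOneSpectrum (𝓞 ↥(maximalRealSubfield L)), BorelSpace ((cmDatum L 3 (Matrix.of fun i j : Fin 3 => if i.val + j.val + 1 = 3 then (1 : L) else 0)).Local v)]
    (νG : ∀ v : HeightOneSpectrum (𝓞 ↥(maximalRealSubfield L)), Measure ((cmDatum L 3 H).Local v)) [∀ v, (νG v).IsMulRightInvariant]
    (v : HeightOneSpectrum (𝓞 ↥(maximalRealSubfield L))) :
    ((νG v).map (cmDatumLocalCongr L v (toLocalGL L v B)⁻¹ (isUnit_algebraMap_localRing L ha0 v) (formCongr_toLocalGL_inv_smul L H B hB v)).symm).IsMulRightInvariant :=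
  isMulRightInvariant_map_cmDatumLocalCongr_symm L H v _ _ _ (νG v)

end Simil

end Summit.HodgeConjecture.HodgeConjecture.R90.S9

end
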